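import Summits.ValiantsHypothesis.ValiantsHypothesis.Theorems.DefinabilityGapPivotCertificate
import Summits.ValiantsHypothesis.ValiantsHypothesis.Theorems.DefinabilityGapSupportRung
import HarnessLib

/-!
# DefinabilityGap — pivot MATCHABILITY of the planted KI design for `m ≥ 66` (unconditional)

Route `route-ValiantsHypothesis-DefinabilityGap`, residual crux `KIPlantedHitting` (item 23547),
rung `R_K1.1` (design girth `2q+1`), ROAD P (the one-column pivot certificate of
`DefinabilityGapPivotCertificate`).  The pivot certificate `KIPivotCertificate m T s₀ r` has two
conditions: (i) the pivot cells `cellEmb m c (r c, s₀)`, `c ∈ T`, are pairwise distinct;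
(ii) every pivot is live under the gadget zeros.  This file proves condition (i) OUTRIGHT:

* `kiPivotMatchableFrom` : for every `m ≥ 66` and every family `T` of at most `2q(m)+1` curves
  there are a column `s₀` and rows `r` with pairwise distinct pivot cells
  (`KIPivotMatchable m T`).

PROOF (Hall + double counting + Cauchy–Schwarz, NODE-v7 §F (N3)).  For a column `s` let
`colCells m c s` be the `m` cells of block `c` in grid column `s`.  If Hall's condition fails in
column `s` for `A ⊆ T` (`|⋃_{c∈A} colCells c s| ≤ |A| − 1`), then with `μ_x` the number
of blocks of `A` through the cell `x`, `Σ μ_x = |A|·m` and `Σ μ_x² = |A|·m + P_s(A)` where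
`P_s(A)` counts ordered pairs of distinct blocks of `A` with a common cell in column `s` (with
multiplicity), so Cauchy–Schwarz gives `(|A| m)² ≤ (|A| − 1)(|A| m + P_s(A))`
(`hall_defect`).
Two blocks share at most `2` cells (`subDesign_isNWDesign`), whence `P_s(A) ≤ 2|A|(|A| − 1)`,
and the two inequalities force `2 P_s(A) ≥ M(M+6) + 2m`, `M = m(m−1)` (`col_arith`).  If Hall
failed in EVERY column, summing over the `m` columns and using that the column-`s`
intersections of two fixed blocks are disjoint for distinct `s` (so their total is still `≤ 2`)
gives `m(M(M+6)+2m) ≤ 4|T|(|T|−1)`, while `|T| ≤ 2q+1 ≤ 4m²+5` (Bertrand,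
`leastPrimeGe_le`) — false for `m ≥ 66`.  So some column satisfies Hall's condition and Hall's
marriage theorem (`Finset.all_card_le_biUnion_card_iff_exists_injective`) gives the rows.

What remains of ROAD P after this file is condition (ii) (liveness) alone.
-/

noncomputable section

open Finset
open Literature.Computability.AlgebraicComplexity Literature.Computability.MetaComplexity
open Summit.ValiantsHypothesis.ValiantsHypothesis.Theorems.DefinabilityGapAffineRung
open Summit.ValiantsHypothesis.ValiantsHypothesis.Theorems.DefinabilityGapSupportRung
open Summit.ValiantsHypothesis.ValiantsHypothesis.Theorems.DefinabilityGapPivotCertificate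

namespace Summit.ValiantsHypothesis.ValiantsHypothesis.Theorems.DefinabilityGapPivotHall

/-! ## 1. An abstract Hall-defect inequality -/

section Abstract

variable {ι α : Type*} [DecidableEq α]

/-- Ordered pairs of distinct blocks of `A`, weighted by the size of their intersection.
[this file] -/
def pairInc [DecidableEq ι] (A : Finset ι) (t : ι → Finset α) : ℕ :=
  ∑ c ∈ A, ∑ c' ∈ A.erase c, (t c ∩ t c').card

/-- `pairInc` is monotone in the family. [this file] -/
theorem pairInc_mono [DecidableEq ι] {A B : Finset ι} (h : A ⊆ B) (t : ι → Finset α) :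
    pairInc A t ≤ pairInc B t := by
  unfold pairInc
  calc ∑ c ∈ A, ∑ c' ∈ A.erase c, (t c ∩ t c').card
      ≤ ∑ c ∈ A, ∑ c' ∈ B.erase c, (t c ∩ t c').card :=
        Finset.sum_le_sum fun c _ => Finset.sum_le_sum_of_subset (Finset.erase_subset_erase c h)
    _ ≤ ∑ c ∈ B, ∑ c' ∈ B.erase c, (t c ∩ t c').card := Finset.sum_le_sum_of_subset h

/-- Double counting, first moment: `Σ_x μ_x = |A|·k` for blocks of size `k`. [this file] -/
theorem sum_mult_eq (A : Finset ι) (t : ι → Finset α) (k : ℕ)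
    (ht : ∀ c ∈ A, (t c).card = k) :
    ∑ x ∈ A.biUnion t, (A.filter fun c => x ∈ t c).card = A.card * k := by
  have h := Finset.sum_card_bipartiteAbove_eq_sum_card_bipartiteBelow
    (s := A) (t := A.biUnion t) (r := fun c x => x ∈ t c)
  have h1 : ∀ c ∈ A, (A.biUnion t).bipartiteAbove (fun c x => x ∈ t c) c = t c := by
    intro c hc
    simp only [Finset.bipartiteAbove, Finset.filter_mem_eq_inter]
    exact Finset.inter_eq_right.mpr (Finset.subset_biUnion_of_mem t hc)
  have h2 : ∀ x, A.bipartiteBelow (fun c x => x ∈ t c) x = A.filter (fun c => x ∈ t c) :=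
    fun x => rfl
  simp only [h2] at h
  rw [← h, Finset.sum_congr rfl (fun c hc => by rw [h1 c hc, ht c hc]), Finset.sum_const,
    smul_eq_mul]

/-- Double counting, second moment: `Σ_x μ_x² = |A|·k + pairInc`. [this file] -/
theorem sum_mult_sq_eq [DecidableEq ι] (A : Finset ι) (t : ι → Finset α) (k : ℕ)
    (ht : ∀ c ∈ A, (t c).card = k) :
    ∑ x ∈ A.biUnion t, (A.filter fun c => x ∈ t c).card ^ 2 = A.card * k + pairInc A t := by
  have hsq : ∀ x, (A.filter fun c => x ∈ t c).card ^ 2 =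
      ((A ×ˢ A).filter fun p : ι × ι => x ∈ t p.1 ∧ x ∈ t p.2).card := by
    intro x
    rw [Finset.filter_product (fun c => x ∈ t c) (fun c => x ∈ t c), Finset.card_product, sq]
  simp only [hsq]
  have h := Finset.sum_card_bipartiteAbove_eq_sum_card_bipartiteBelow
    (s := A ×ˢ A) (t := A.biUnion t) (r := fun p x => x ∈ t p.1 ∧ x ∈ t p.2)
  have h1 : ∀ p ∈ A ×ˢ A,
      (A.biUnion t).bipartiteAbove (fun p x => x ∈ t p.1 ∧ x ∈ t p.2) p =
        t p.1 ∩ t p.2 := by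
    intro p hp
    ext x
    simp only [Finset.bipartiteAbove, Finset.mem_filter, Finset.mem_inter, Finset.mem_biUnion]
    constructor
    · rintro ⟨_, hx1, hx2⟩
      exact ⟨hx1, hx2⟩
    · rintro ⟨hx1, hx2⟩
      exact ⟨⟨p.1, (Finset.mem_product.mp hp).1, hx1⟩, hx1, hx2⟩
  have h2 : ∀ x, (A ×ˢ A).bipartiteBelow (fun p x => x ∈ t p.1 ∧ x ∈ t p.2) x =
      (A ×ˢ A).filter (fun p => x ∈ t p.1 ∧ x ∈ t p.2) := fun x => rfl
  simp only [h2] at h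
  rw [← h, Finset.sum_congr rfl (fun p hp => by rw [h1 p hp]), Finset.sum_product]
  have h3 : ∀ c ∈ A,
      ∑ c' ∈ A, (t c ∩ t c').card = k + ∑ c' ∈ A.erase c, (t c ∩ t c').card := by
    intro c hc
    rw [← Finset.add_sum_erase A (fun c' => (t c ∩ t c').card) hc, Finset.inter_self, ht c hc]
  unfold pairInc
  rw [Finset.sum_congr rfl h3, Finset.sum_add_distrib, Finset.sum_const, smul_eq_mul]

/-- **Hall defect inequality** (Cauchy–Schwarz on the multiplicities): for blocks of size `k`,
`(|A| k)² ≤ |⋃ A| · (|A| k + pairInc A)`. [this file] -/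
theorem hall_defect [DecidableEq ι] (A : Finset ι) (t : ι → Finset α) (k : ℕ)
    (ht : ∀ c ∈ A, (t c).card = k) :
    (A.card * k) ^ 2 ≤ (A.biUnion t).card * (A.card * k + pairInc A t) := by
  rw [← sum_mult_sq_eq A t k ht, ← sum_mult_eq A t k ht]
  exact sq_sum_le_card_mul_sum_sq

end Abstract

/-- **Column arithmetic.** From the Hall defect inequality with `|⋃ A| ≤ |A| − 1 = k` and the
pair bound `P ≤ 2|A|(|A|−1)`: `2P ≥ M(M+6) + 2m` where `M = m(m−1)`. [this file] -/
theorem col_arith (m M k P B : ℕ) (hm : 2 ≤ m) (hM : M + m = m * m) (hMe : Even M)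
    (hB : B ≤ k)
    (h1 : ((k + 1) * m) ^ 2 ≤ B * ((k + 1) * m + P)) (h2 : P ≤ 2 * ((k + 1) * k)) :
    M * (M + 6) + 2 * m ≤ 2 * P := by
  have h1' : ((k + 1) * m) ^ 2 ≤ k * ((k + 1) * m + P) := h1.trans (Nat.mul_le_mul_right _ hB)
  have hk : 1 ≤ k := by
    rcases Nat.eq_zero_or_pos k with rfl | hk
    · have e : ((0 + 1) * m) ^ 2 = m * m := by ring
      rw [e, zero_mul] at h1'
      nlinarith
    · exact hk
  have e : ((k + 1) * m) ^ 2 = (k + 1) * ((k + 1) * (M + m)) := by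
    rw [hM]; ring
  have h2k : k * P ≤ k * (2 * ((k + 1) * k)) := Nat.mul_le_mul_left k h2
  -- Step B: `(k+1)(M+m) ≤ k m + 2 k²`.
  have eB : (k + 1) * ((k + 1) * (M + m)) ≤ (k + 1) * (k * m + 2 * k * k) := by
    have e2 : (k + 1) * (k * m + 2 * k * k) = k * ((k + 1) * m) + k * (2 * ((k + 1) * k)) := by
      ring
    rw [← e, e2]
    linarith
  have sB : (k + 1) * (M + m) ≤ k * m + 2 * k * k := Nat.le_of_mul_le_mul_left eB (Nat.succ_pos k)
  -- Step C: `M + 2 ≤ 2k`.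
  have sC0 : k * M < k * (2 * k) := by nlinarith
  have sC1 : M < 2 * k := Nat.lt_of_mul_lt_mul_left sC0
  have sC : M + 2 ≤ 2 * k := by
    obtain ⟨j, hj⟩ := hMe
    omega
  -- Step D: `(k+2)(M+m) ≤ (k+1)m + P`.
  have eD : k * ((k + 2) * (M + m)) ≤ k * ((k + 1) * m + P) := by
    have e3 : k * ((k + 2) * (M + m)) + (M + m) = ((k + 1) * m) ^ 2 := by rw [e]; ring
    linarith
  have sD : (k + 2) * (M + m) ≤ (k + 1) * m + P := Nat.le_of_mul_le_mul_left eD hk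
  -- Step E.
  have hE : (M + 2) * M ≤ 2 * k * M := Nat.mul_le_mul_right M sC
  nlinarith

variable {m : ℕ}

/-! ## 2. Column cells of the planted design -/

/-- The `m` cells of block `c` in grid column `s` (positions `(a, s)`, `a : Fin m`). [this file] -/
def colCells (m : ℕ) (c : Fin 3 → Fin (qOf m)) (s : Fin m) :
    Finset (Fin (qOf m) × Fin (qOf m)) :=
  Finset.univ.image fun a : Fin m => cellEmb m c (a, s)

/-- Membership in a column. [this file] -/
theorem mem_colCells {c : Fin 3 → Fin (qOf m)} {s : Fin m} {x : Fin (qOf m) × Fin (qOf m)} :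
    x ∈ colCells m c s ↔ ∃ a, cellEmb m c (a, s) = x := by
  simp [colCells]

/-- A column of a block has exactly `m` cells. [this file] -/
theorem colCells_card (c : Fin 3 → Fin (qOf m)) (s : Fin m) : (colCells m c s).card = m := by
  rw [colCells, Finset.card_image_of_injective _ (fun a b h => ?_), Finset.card_univ,
    Fintype.card_fin]
  exact (Prod.ext_iff.mp ((cellEmb m c).injective h)).1

/-- Column cells are cells of the block. [this file] -/
theorem colCells_subset (c : Fin 3 → Fin (qOf m)) (s : Fin m) :
    colCells m c s ⊆ Finset.univ.map (cellEmb m c) := by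
  intro x hx
  obtain ⟨a, rfl⟩ := mem_colCells.mp hx
  exact Finset.mem_map_of_mem _ (Finset.mem_univ _)

/-- Different columns of one block are disjoint. [this file] -/
theorem colCells_disjoint (c : Fin 3 → Fin (qOf m)) {s s' : Fin m} (h : s ≠ s') :
    Disjoint (colCells m c s) (colCells m c s') := by
  rw [Finset.disjoint_left]
  intro x hx hx'
  obtain ⟨a, rfl⟩ := mem_colCells.mp hx
  obtain ⟨b, hb⟩ := mem_colCells.mp hx'
  exact h (Prod.ext_iff.mp ((cellEmb m c).injective hb)).2.symm

/-- **Two blocks share at most two cells, summed over the columns.** [this file] -/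
theorem sum_card_colCells_inter_le {c c' : Fin 3 → Fin (qOf m)} (hcc' : c ≠ c') :
    ∑ s : Fin m, (colCells m c s ∩ colCells m c' s).card ≤ 2 := by
  have hd : (Finset.univ.map (cellEmb m c) ∩ Finset.univ.map (cellEmb m c')).card ≤ 2 :=
    subDesign_isNWDesign m hcc'
  rw [← Finset.card_biUnion]
  · refine le_trans (Finset.card_le_card ?_) hd
    intro x hx
    obtain ⟨s, -, hs⟩ := Finset.mem_biUnion.mp hx
    rw [Finset.mem_inter] at hs ⊢
    exact ⟨colCells_subset c s hs.1, colCells_subset c' s hs.2⟩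
  · intro s _ s' _ hss'
    exact Disjoint.mono Finset.inter_subset_left Finset.inter_subset_left
      (colCells_disjoint c hss')

/-- The column cells of the members of a family `T`, as a block map on the subtype. [this file] -/
def colOf (T : Finset (Fin 3 → Fin (qOf m))) (s : Fin m) (c : T) :
    Finset (Fin (qOf m) × Fin (qOf m)) :=
  colCells m (c : Fin 3 → Fin (qOf m)) s

/-- The pair bound in one column: `P_s(A) ≤ 2|A|(|A|−1)`. [this file] -/
theorem pairInc_col_le (T : Finset (Fin 3 → Fin (qOf m))) (A : Finset T) (s : Fin m) :
    pairInc A (colOf T s) ≤ 2 * (A.card * (A.card - 1)) := by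
  classical
  unfold pairInc
  calc ∑ c ∈ A, ∑ c' ∈ A.erase c, (colOf T s c ∩ colOf T s c').card
      ≤ ∑ c ∈ A, ∑ c' ∈ A.erase c, 2 := by
        refine Finset.sum_le_sum fun c _ => Finset.sum_le_sum fun c' hc' => ?_
        have hne : (c : Fin 3 → Fin (qOf m)) ≠ c' :=
          fun h => Finset.ne_of_mem_erase hc' (Subtype.ext h).symm
        calc (colOf T s c ∩ colOf T s c').card
            ≤ ∑ s' : Fin m, (colOf T s' c ∩ colOf T s' c').card :=
              Finset.single_le_sum (f := fun s' : Fin m => (colOf T s' c ∩ colOf T s' c').card)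
                (fun _ _ => Nat.zero_le _) (Finset.mem_univ s)
          _ ≤ 2 := sum_card_colCells_inter_le hne
    _ = 2 * (A.card * (A.card - 1)) := by
        rw [Finset.sum_congr rfl fun c hc => by
          rw [Finset.sum_const, Finset.card_erase_of_mem hc, smul_eq_mul]]
        rw [Finset.sum_const, smul_eq_mul]
        ring

/-- The global pair bound: summed over all columns, `Σ_s P_s(A_s) ≤ 2|T|(|T|−1)`.
[this file] -/
theorem sum_pairInc_le (T : Finset (Fin 3 → Fin (qOf m))) (A : Fin m → Finset T) :
    ∑ s, pairInc (A s) (colOf T s) ≤ 2 * (T.card * (T.card - 1)) := by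
  classical
  calc ∑ s, pairInc (A s) (colOf T s)
      ≤ ∑ s, pairInc (Finset.univ : Finset T) (colOf T s) :=
        Finset.sum_le_sum fun s _ => pairInc_mono (Finset.subset_univ _) _
    _ = ∑ c : T, ∑ c' ∈ Finset.univ.erase c, ∑ s : Fin m,
          (colOf T s c ∩ colOf T s c').card := by
        unfold pairInc
        rw [Finset.sum_comm]
        exact Finset.sum_congr rfl fun c _ => Finset.sum_comm
    _ ≤ ∑ c : T, ∑ c' ∈ Finset.univ.erase c, 2 :=
        Finset.sum_le_sum fun c _ => Finset.sum_le_sum fun c' hc' =>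
          sum_card_colCells_inter_le fun h => Finset.ne_of_mem_erase hc' (Subtype.ext h).symm
    _ = 2 * (T.card * (T.card - 1)) := by
        rw [Finset.sum_congr rfl fun c _ => by
          rw [Finset.sum_const, Finset.card_erase_of_mem (Finset.mem_univ _), smul_eq_mul]]
        rw [Finset.sum_const, smul_eq_mul, Finset.card_univ, Fintype.card_coe]
        ring

/-! ## 3. Matchability -/

/-- **Pivot matchability** (condition (i) of `KIPivotCertificate`): a column `s₀` and rows `r`
whose pivot cells `cellEmb m c (r c, s₀)`, `c ∈ T`, are pairwise distinct. [this file] -/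
def KIPivotMatchable (m : ℕ) (T : Finset (Fin 3 → Fin (qOf m))) : Prop :=
  ∃ (s₀ : Fin m) (r : (Fin 3 → Fin (qOf m)) → Fin m),
    ∀ c ∈ T, ∀ c' ∈ T, cellEmb m c (r c, s₀) = cellEmb m c' (r c', s₀) → c = c'

/-- Matchability of every family of at most `t m` curves, for all `m ≥ m₁`. [this file] -/
def KIPivotMatchableFrom (m₁ : ℕ) (t : ℕ → ℕ) : Prop :=
  ∀ m, m₁ ≤ m → ∀ T : Finset (Fin 3 → Fin (qOf m)), T.card ≤ t m →
    KIPivotMatchable m T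

/-- A pivot certificate is in particular a matching. [this file] -/
theorem kiPivotMatchable_of_certificate {T : Finset (Fin 3 → Fin (qOf m))} {s₀ : Fin m}
    {r : (Fin 3 → Fin (qOf m)) → Fin m} (h : KIPivotCertificate m T s₀ r) :
    KIPivotMatchable m T :=
  ⟨s₀, r, h.1⟩

/-- **Hall ⟹ matchable**: Hall's condition for the column cells in one column gives the rows.
[this file] -/
theorem kiPivotMatchable_of_hall (T : Finset (Fin 3 → Fin (qOf m))) (s₀ : Fin m)
    (hH : ∀ A : Finset T, A.card ≤ (A.biUnion (colOf T s₀)).card) :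
    KIPivotMatchable m T := by
  classical
  obtain ⟨f, hf, hft⟩ :=
    (Finset.all_card_le_biUnion_card_iff_exists_injective (colOf T s₀)).mp hH
  have hrow : ∀ c : T, ∃ a : Fin m, cellEmb m (c : Fin 3 → Fin (qOf m)) (a, s₀) = f c :=
    fun c => mem_colCells.mp (hft c)
  choose a ha using hrow
  refine ⟨s₀, fun c => if h : c ∈ T then a ⟨c, h⟩ else s₀, ?_⟩
  intro c hc c' hc' h
  have h' : cellEmb m c (a ⟨c, hc⟩, s₀) = cellEmb m c' (a ⟨c', hc'⟩, s₀) := by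
    simpa [dif_pos hc, dif_pos hc'] using h
  have e1 := ha ⟨c, hc⟩
  have e2 := ha ⟨c', hc'⟩
  simp only at e1 e2
  rw [e1, e2] at h'
  exact congrArg Subtype.val (hf h')

/-- **MATCHABILITY THEOREM.** For `m ≥ 66`, every family of at most `2q(m)+1` blocks of the
planted design admits a column and rows with pairwise distinct pivot cells. [this file] -/
theorem kiPivotMatchableFrom : KIPivotMatchableFrom 66 (fun m => 2 * qOf m + 1) := by
  intro m hm T hT
  classical
  have hT : T.card ≤ 2 * qOf m + 1 := hT
  by_contra hneg
  have hcol : ∀ s : Fin m, ∃ A : Finset T, (A.biUnion (colOf T s)).card < A.card := by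
    intro s
    by_contra h
    exact hneg (kiPivotMatchable_of_hall T s fun A => not_lt.mp fun hlt => h ⟨A, hlt⟩)
  choose A hA using hcol
  have hm2 : 2 ≤ m := by omega
  set M := m * (m - 1) with hMdef
  have hM : M + m = m * m := by
    obtain ⟨x, rfl⟩ : ∃ x, m = x + 1 := ⟨m - 1, by omega⟩
    simp only [hMdef, Nat.add_sub_cancel]
    ring
  have hMe : Even M := Nat.even_mul_pred_self m
  -- every column has a large pair incidence
  have percol : ∀ s, M * (M + 6) + 2 * m ≤ 2 * pairInc (A s) (colOf T s) := by
    intro s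
    have hAs := hA s
    obtain ⟨k, hk⟩ : ∃ k, (A s).card = k + 1 := ⟨(A s).card - 1, by omega⟩
    have hd := hall_defect (A s) (colOf T s) m (fun c _ => colCells_card _ _)
    have hp := pairInc_col_le T (A s) s
    rw [hk] at hd hAs hp
    exact col_arith m M k _ _ hm2 hM hMe (by omega) hd (by simpa using hp)
  have hsum : m * (M * (M + 6) + 2 * m) ≤ 2 * ∑ s, pairInc (A s) (colOf T s) := by
    have h := Finset.sum_le_sum fun s (_ : s ∈ (Finset.univ : Finset (Fin m))) => percol s
    simp only [Finset.sum_const, Finset.card_univ, Fintype.card_fin, smul_eq_mul] at h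
    rw [Finset.mul_sum]
    exact h
  have hglob := sum_pairInc_le T A
  have hq : qOf m ≤ 2 * (m * m + 1) := leastPrimeGe_le _ (by omega)
  have hN : T.card ≤ 4 * (m * m) + 5 := by omega
  have hNN : T.card * (T.card - 1) ≤ (4 * (m * m) + 5) * (4 * (m * m) + 4) :=
    Nat.mul_le_mul hN (by omega)
  have H : m * (M * (M + 6) + 2 * m) ≤ 4 * ((4 * (m * m) + 5) * (4 * (m * m) + 4)) := by
    calc m * (M * (M + 6) + 2 * m)
        ≤ 2 * ∑ s, pairInc (A s) (colOf T s) := hsum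
      _ ≤ 2 * (2 * (T.card * (T.card - 1))) := Nat.mul_le_mul_left 2 hglob
      _ ≤ 2 * (2 * ((4 * (m * m) + 5) * (4 * (m * m) + 4))) :=
          Nat.mul_le_mul_left 2 (Nat.mul_le_mul_left 2 hNN)
      _ = 4 * ((4 * (m * m) + 5) * (4 * (m * m) + 4)) := by ring
  -- arithmetic contradiction for `m ≥ 66`
  have f4 : 66 * m ≤ m * m := Nat.mul_le_mul_right m hm
  have hM1 : 65 * m ≤ M := by omega
  have f1 : 66 * (M * M) ≤ m * (M * M) := Nat.mul_le_mul_right _ hm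
  have f2 : 65 * m * M ≤ M * M := Nat.mul_le_mul_right M hM1
  have f3 : 65 * m * m ≤ M * m := Nat.mul_le_mul_right m hM1
  have f5 : (M + m) * (M + m) = (m * m) * (m * m) := by rw [hM]
  nlinarith [f1, f2, f3, f5, hM, H, f4]

end Summit.ValiantsHypothesis.ValiantsHypothesis.Theorems.DefinabilityGapPivotHall
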